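import Literature.Computability.QuantumComplexity.BQPCollapsingOracle
import HarnessLib

/-!
# Oracle worlds built by recursion on length: reserved strings, self-encoded `BQP` codes with a promise gap

Topic `Literature/Computability/QuantumComplexity`. Infrastructure for the oracle of
`FortnowRogersOracle.lean` (an oracle `C` with `BQP^C ⊆ P^C` and `P^C ≠ UP^C ∩ coUP^C`, the
core of Fortnow–Rogers 1999, Thm. 4.2, proved there by Ko's encoding technique joined with a
Baker–Gill–Solovay diagonalization instead of the printed `PSPACE`-complete set joined with a
`UP ∩ coUP`-generic).

* `FRO.build ρ` — the language defined by recursion on the length of strings from a *rule*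
  `ρ X s` ("put `s` in, given the part `X` of the language below `|s|`"), exactly as the tree's
  `BQPCollapse.oracleA` / `BGS.oracleA` (Ko 1989, §5: "whether an instance `x` is in `K(A)`
  depends only on the set `A_{<|x|}`"), together with the fixed-point equation `mem_build_iff`
  and the agreement principle `build_congr` (two rules that agree on a set `S` of strings, given
  parts that agree on `S` below, build languages that agree on `S`).
* The two kinds of strings of the oracle: reserved strings `rsv z w = 0⟨z, w⟩` (tag bit `false`)
  carrying the `UP ∩ coUP` witnesses, and code strings `ccode x m C = 1⟨⟨x, σ(C)⟩, ε⟩` (tag bit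
  `true`; the instance code `BQPCollapse.code x m C` of "does the Clifford+T oracle circuit `C` on
  `|x| + m` wires accept `x`?", doubled by the pairing so that a code only queries strings of less
  than half its length, `CodeAcc.congr`).
* `CodeAcc X a b r s` — the valuation rule of codes WITH A PROMISE GAP: `s` is a code whose circuit
  accepts (relative to `X`) with probability `≥ a`, or with probability `> b` while the fallback
  bit `r` holds. With `(a, b) = (1/2, 1/2)` this is the canonical threshold rule of
  `BQPCollapse.Holds`; with `(a, b) = (2/3, 1/3)` the value inside the gap `(1/3, 2/3)` is the free
  bit `r` — the freedom a diagonalization needs (Ko 1989, p. 24, scheme (2): only the instances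
  satisfying the promise are constrained).
* `world p a b ref` — the language with reserved part given by the placement `p` (`rsv z w` is in
  iff `p z = some w`) and codes valued by `CodeAcc` with length-dependent thresholds `a`, `b` and
  fallback `ref`; `rsv_mem_world_iff`, `ccode_mem_world_iff` (the fixed-point equations),
  `world_congr` (agreement principle), and `BQPRel_world_subset_PRel`: **`BQP^W ⊆ P^W` for every
  such world with `1/3 < a ≤ 2/3`, `1/3 ≤ b`** (codes satisfying the `BQP` promise are valued correctly,
  so every `BQP^W` language Karp-reduces to `W`, as in `BQPCollapse.karpReducible_oracleA`).

## References

* [Ko1989] K.-I Ko, *Constructing oracles by lower bound techniques for circuits*, in: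
  Combinatorics, Computing and Complexity (Kluwer, 1989) 30–76, §5 (p. 21: `K(A)` depends only on
  `A_{<|x|}`), p. 24 (collapse scheme (2)).
* [FortnowRogers1999JCSS] L. Fortnow, J. Rogers, *Complexity limitations on quantum computation*,
  JCSS 59 (1999) 240–252 = arXiv:cs/9811023, Thm. 4.2 and its proof (p. 7, arXiv numbering).
* [AroraBarakCC2009] S. Arora, B. Barak, *Computational Complexity: A Modern Approach*, CUP 2009,
  §3.4 (oracle machines), Thm. 3.7 (diagonalization against `P^B`).
-/

noncomputable section

namespace Literature.Computability.QuantumComplexity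

open _root_.Computability Complexity Complexity.Classes Cryptography
open scoped Complexity.Notation

namespace FRO

/-! ### Languages built by recursion on the length of strings -/

/-- The stages of the language built from the rule `ρ`: `belowB ρ n` is its set of strings of
length `< n`; a string `s` of length `n` is put in iff `ρ (belowB ρ n) s`.
[cite: Ko1989, §5 (p. 21)] -/
def belowB (ρ : Set (List Bool) → List Bool → Prop) : ℕ → Set (List Bool)
  | 0 => ∅
  | n + 1 => belowB ρ n ∪ {s | s.length = n ∧ ρ (belowB ρ n) s}

/-- **The language built from the rule `ρ` by recursion on length.** [cite: Ko1989, §5 (p. 21)] -/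
def build (ρ : Set (List Bool) → List Bool → Prop) : Set (List Bool) :=
  {s | s ∈ belowB ρ (s.length + 1)}

variable {ρ : Set (List Bool) → List Bool → Prop}

/-- Strings of stage `n` are shorter than `n`. [folklore] -/
theorem length_lt_of_mem_belowB {n : ℕ} {s : List Bool} (h : s ∈ belowB ρ n) : s.length < n := by
  induction n with
  | zero => simp [belowB] at h
  | succ n ih =>
    simp only [belowB, Set.mem_union, Set.mem_setOf_eq] at h
    rcases h with h | h
    · exact Nat.lt_succ_of_lt (ih h)
    · omega

/-- The stages are cumulative. [folklore] -/
theorem mem_belowB_iff_of_lt {n : ℕ} {s : List Bool} (h : s.length < n) :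
    s ∈ belowB ρ n ↔ s ∈ build ρ := by
  change _ ↔ s ∈ belowB ρ (s.length + 1)
  induction n with
  | zero => omega
  | succ n ih =>
    rcases Nat.lt_succ_iff_lt_or_eq.1 h with hlt | heq
    · rw [← ih hlt]
      simp only [belowB, Set.mem_union, Set.mem_setOf_eq]
      constructor
      · rintro (h' | h')
        · exact h'
        · omega
      · exact Or.inl
    · rw [heq]

/-- **The fixed-point equation**: `s` is in the built language iff the rule puts it in, given the
part of the language below `|s|`. [cite: Ko1989, §5 (p. 21)] -/
theorem mem_build_iff (s : List Bool) : s ∈ build ρ ↔ ρ (belowB ρ s.length) s := by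
  change s ∈ belowB ρ s.length ∪ {t | t.length = s.length ∧ ρ (belowB ρ s.length) t} ↔ _
  rw [Set.mem_union, Set.mem_setOf_eq]
  constructor
  · rintro (h | h)
    · exact absurd (length_lt_of_mem_belowB h) (lt_irrefl _)
    · exact h.2
  · exact fun h => Or.inr ⟨rfl, h⟩

/-- A string of length `< n` is in stage `n` iff it is in the built language; longer strings are
not in stage `n`. [folklore] -/
theorem mem_belowB_iff {n : ℕ} (s : List Bool) : s ∈ belowB ρ n ↔ s ∈ build ρ ∧ s.length < n := by
  constructor
  · intro h
    exact ⟨(mem_belowB_iff_of_lt (length_lt_of_mem_belowB h)).1 h, length_lt_of_mem_belowB h⟩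
  · rintro ⟨h, hlt⟩
    exact (mem_belowB_iff_of_lt hlt).2 h

/-- **Agreement principle.** If on a set `S` of strings two rules agree whenever their arguments
agree on the strings of `S` below, then the two built languages agree on `S` (strong induction
on length). [folklore] -/
theorem build_congr {ρ₁ ρ₂ : Set (List Bool) → List Bool → Prop} (S : Set (List Bool))
    (h : ∀ s ∈ S, ∀ X₁ X₂ : Set (List Bool),
      (∀ u ∈ S, u.length < s.length → (u ∈ X₁ ↔ u ∈ X₂)) → (ρ₁ X₁ s ↔ ρ₂ X₂ s)) :
    ∀ s ∈ S, s ∈ build ρ₁ ↔ s ∈ build ρ₂ := by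
  suffices H : ∀ n, ∀ s ∈ S, s.length < n → (s ∈ build ρ₁ ↔ s ∈ build ρ₂) from
    fun s hs => H _ s hs (Nat.lt_succ_self _)
  intro n
  induction n with
  | zero => intro s _ hs; omega
  | succ n ih =>
    intro s hs hlt
    rw [mem_build_iff, mem_build_iff]
    refine h s hs _ _ fun u hu hul => ?_
    rw [mem_belowB_iff, mem_belowB_iff, ih u hu (by omega)]

/-! ### Reserved strings and code strings -/

/-- The reserved string `rsv z w = 0⟨z, w⟩` ("`w` is the witness of `z`"). [folklore] -/
def rsv (z w : List Bool) : List Bool :=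
  false :: boolPair z w

/-- The code string `cstr c = 1⟨c, ε⟩` of an instance code `c` (the pairing doubles `c`). [folklore] -/
def cstr (c : List Bool) : List Bool :=
  true :: boolPair c []

/-- `|rsv z w| = 2|z| + 3 + |w|`. [folklore] -/
@[simp] theorem length_rsv (z w : List Bool) : (rsv z w).length = 2 * z.length + 3 + w.length := by
  simp only [rsv, List.length_cons, length_boolPair]; omega

/-- `|cstr c| = 2|c| + 3`. [folklore] -/
@[simp] theorem length_cstr (c : List Bool) : (cstr c).length = 2 * c.length + 3 := by
  simp only [cstr, List.length_cons, length_boolPair, List.length_nil]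

/-- `rsv` is injective in both arguments. [folklore] -/
theorem rsv_inj {z w z' w' : List Bool} : rsv z w = rsv z' w' ↔ z = z' ∧ w = w' := by
  constructor
  · intro h
    have h1 : boolPair z w = boolPair z' w' := List.tail_eq_of_cons_eq h
    exact QCircuit.boolPair_inj h1
  · rintro ⟨rfl, rfl⟩
    rfl

/-- `cstr` is injective. [folklore] -/
theorem cstr_inj {c c' : List Bool} : cstr c = cstr c' ↔ c = c' := by
  constructor
  · intro h
    have h1 : boolPair c [] = boolPair c' [] := List.tail_eq_of_cons_eq h
    exact (QCircuit.boolPair_inj h1).1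
  · rintro rfl
    rfl

/-- A reserved string is not a code string (tag bits differ). [folklore] -/
theorem rsv_ne_cstr (z w c : List Bool) : rsv z w ≠ cstr c := by
  simp [rsv, cstr]

/-- The reserved part of a placement `p : z ↦ witness of z` (if any). [folklore] -/
def R (p : List Bool → Option (List Bool)) : Set (List Bool) :=
  {s | ∃ z w, p z = some w ∧ s = rsv z w}

/-- `rsv z w` is reserved iff `w` is the witness placed at `z`. [folklore] -/
@[simp] theorem rsv_mem_R_iff {p : List Bool → Option (List Bool)} {z w : List Bool} :
    rsv z w ∈ R p ↔ p z = some w := by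
  constructor
  · rintro ⟨z', w', h, h'⟩
    obtain ⟨rfl, rfl⟩ := rsv_inj.1 h'
    exact h
  · exact fun h => ⟨z, w, h, rfl⟩

/-- Code strings are not reserved. [folklore] -/
theorem cstr_not_mem_R (p : List Bool → Option (List Bool)) (c : List Bool) : cstr c ∉ R p := by
  rintro ⟨z, w, -, h⟩
  exact rsv_ne_cstr z w c h.symm

/-- A reserved string has the form `rsv z w`. [folklore] -/
theorem exists_eq_rsv_of_mem_R {p : List Bool → Option (List Bool)} {s : List Bool} (h : s ∈ R p) :
    ∃ z w, p z = some w ∧ s = rsv z w :=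
  h

/-! ### Codes of `BQP` instances -/

/-- The code string of the instance "does the Clifford+T oracle circuit `C` on `|x| + m` wires
accept `x`?": `cstr (BQPCollapse.code x m C)`. [cite: Ko1989, §5 (p. 21)] -/
def ccode (x : List Bool) (m : ℕ) (C : QCircuit cliffordT (x.length + m)) : List Bool :=
  cstr (BQPCollapse.code x m C)

/-- Codes are uniquely decodable. [folklore] -/
theorem ccode_inj {x x' : List Bool} {m m' : ℕ} {C : QCircuit cliffordT (x.length + m)}
    {C' : QCircuit cliffordT (x'.length + m')} (h : ccode x m C = ccode x' m' C') :
    ∃ hx : x = x', ∃ hm : m = m', C' = cast (by subst hx; subst hm; rfl) C :=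
  BQPCollapse.code_inj (cstr_inj.1 h)

/-- **A code only sees strings of less than half its length**: the circuit of `ccode x m C` has
`N = |x| + m` wires, and `2(N - 1) + 7 ≤ |ccode x m C|`; it queries strings of length `< N` only.
[folklore] -/
theorem two_mul_wires_add_le (x : List Bool) (m : ℕ) (C : QCircuit cliffordT (x.length + m)) :
    2 * (x.length + m) + 5 ≤ (ccode x m C).length := by
  have := BQPCollapse.lt_length_code x m C
  simp only [ccode, length_cstr]
  omega

/-- A code string is not reserved. [folklore] -/
theorem ccode_ne_rsv (x : List Bool) (m : ℕ) (C : QCircuit cliffordT (x.length + m)) (z w : List Bool) :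
    ccode x m C ≠ rsv z w :=
  fun h => rsv_ne_cstr z w _ h.symm

/-- The number of gates of a circuit is at most the length of its encoding (each gate costs at
least the two separator bits of the pairing). [folklore] -/
theorem size_le_length_encode {N : ℕ} (C : QCircuit cliffordT N) : C.size ≤ C.encode.length := by
  obtain ⟨gs⟩ := C
  simp only [QCircuit.size, QCircuit.encode]
  induction gs with
  | nil => simp
  | cons g gs ih =>
    simp only [List.length_cons, List.foldr_cons, length_boolPair]
    omega

/-- The number of oracle gates of the circuit of a code is less than half the length of the code.
[folklore] -/
theorem two_mul_oracleQueries_lt (x : List Bool) (m : ℕ) (C : QCircuit cliffordT (x.length + m)) :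
    2 * C.oracleQueries + 3 ≤ (ccode x m C).length := by
  have h1 : C.oracleQueries ≤ C.size := by
    unfold QCircuit.oracleQueries QCircuit.size
    exact List.length_filter_le _ _
  have h2 := size_le_length_encode C
  have h3 : C.encode.length ≤ (BQPCollapse.code x m C).length := by
    simp only [BQPCollapse.code, QCircuit.sigmaEncode, length_boolPair]
    omega
  simp only [ccode, length_cstr]
  omega

/-! ### The valuation of codes with a promise gap -/

/-- **Code valuation with a promise gap.** `CodeAcc X a b r s`: `s` is the code of an instance
`(x, m, C)` whose circuit, run on `|x⟩|0^m⟩` with its query gates answered by `X`, accepts with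
probability `≥ a`, or with probability `> b` while the fallback `r` holds. For `a = b = 1/2` this
is the canonical threshold rule (`BQPCollapse.Holds`); for `(a, b) = (2/3, 1/3)` the value in the
gap `(1/3, 2/3)` is the free bit `r`. [cite: Ko1989, p. 24 (2)] -/
def CodeAcc (X : Set (List Bool)) (a b : ℝ) (r : Prop) (s : List Bool) : Prop :=
  ∃ (x : List Bool) (m : ℕ) (C : QCircuit cliffordT (x.length + m)),
    s = ccode x m C ∧ (a ≤ C.acceptProb X x.get ∨ (b < C.acceptProb X x.get ∧ r))

/-- The valuation of a code in terms of its own instance. [folklore] -/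
theorem codeAcc_ccode_iff {X : Set (List Bool)} {a b : ℝ} {r : Prop} {x : List Bool} {m : ℕ}
    {C : QCircuit cliffordT (x.length + m)} :
    CodeAcc X a b r (ccode x m C) ↔ a ≤ C.acceptProb X x.get ∨ (b < C.acceptProb X x.get ∧ r) := by
  constructor
  · rintro ⟨x', m', C', h, h'⟩
    obtain ⟨rfl, rfl, rfl⟩ := ccode_inj h
    exact h'
  · exact fun h => ⟨x, m, C, rfl, h⟩

/-- Reserved strings are never valued as codes. [folklore] -/
theorem not_codeAcc_rsv (X : Set (List Bool)) (a b : ℝ) (r : Prop) (z w : List Bool) :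
    ¬ CodeAcc X a b r (rsv z w) := by
  rintro ⟨x, m, C, h, -⟩
  exact ccode_ne_rsv x m C z w h.symm

/-- A valued string is a code. [folklore] -/
theorem CodeAcc.exists_eq {X : Set (List Bool)} {a b : ℝ} {r : Prop} {s : List Bool}
    (h : CodeAcc X a b r s) :
    ∃ (x : List Bool) (m : ℕ) (C : QCircuit cliffordT (x.length + m)), s = ccode x m C := by
  obtain ⟨x, m, C, h, -⟩ := h
  exact ⟨x, m, C, h⟩

/-- **Locality of the code valuation**: it depends only on the strings `u` of the oracle with
`2|u| + 7 ≤ |s|` (the circuit of a code of length `ℓ` has at most `(ℓ - 5)/2` wires). [folklore] -/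
theorem CodeAcc.congr {X₁ X₂ : Set (List Bool)} {a b : ℝ} {r₁ r₂ : Prop} {s : List Bool}
    (h : ∀ u : List Bool, 2 * u.length + 7 ≤ s.length → (u ∈ X₁ ↔ u ∈ X₂)) (hr : r₁ ↔ r₂) :
    CodeAcc X₁ a b r₁ s ↔ CodeAcc X₂ a b r₂ s := by
  constructor
  · rintro ⟨x, m, C, rfl, h'⟩
    have hw := two_mul_wires_add_le x m C
    rw [C.acceptProb_congr (B := X₂) (fun u hu => h u (by omega)), hr] at h'
    exact ⟨x, m, C, rfl, h'⟩
  · rintro ⟨x, m, C, rfl, h'⟩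
    have hw := two_mul_wires_add_le x m C
    rw [← C.acceptProb_congr (A := X₁) (fun u hu => h u (by omega)), ← hr] at h'
    exact ⟨x, m, C, rfl, h'⟩

/-! ### Worlds: a placement of witnesses plus self-encoded codes -/

/-- **The world** of the placement `p` with thresholds `a`, `b` (depending on the length of the
code) and fallback bits `ref`: the language `X` with `rsv z w ∈ X ↔ p z = some w` and
`ccode x m C ∈ X ↔ a ≤ P ∨ (b < P ∧ ref (ccode x m C))`, `P` the acceptance probability of `C` on
`x` relative to `X` itself (well defined by recursion on length: the circuit only queries shorter
strings). [cite: Ko1989, §5 (p. 21) and p. 24 (2)] -/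
def world (p : List Bool → Option (List Bool)) (a b : ℕ → ℝ) (ref : List Bool → Prop) : Set (List Bool) :=
  build fun X s => s ∈ R p ∨ CodeAcc X (a s.length) (b s.length) (ref s) s

section World

variable (p : List Bool → Option (List Bool)) (a b : ℕ → ℝ) (ref : List Bool → Prop)

/-- Unfolding of membership in a world. [folklore] -/
theorem mem_world_iff (s : List Bool) :
    s ∈ world p a b ref ↔ s ∈ R p ∨
      CodeAcc (belowB (fun X s => s ∈ R p ∨ CodeAcc X (a s.length) (b s.length) (ref s) s) s.length)
        (a s.length) (b s.length) (ref s) s :=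
  mem_build_iff s

/-- Every string of a world is reserved or a code. [folklore] -/
theorem mem_R_or_exists_of_mem_world {s : List Bool} (h : s ∈ world p a b ref) :
    s ∈ R p ∨ ∃ (x : List Bool) (m : ℕ) (C : QCircuit cliffordT (x.length + m)), s = ccode x m C := by
  rcases (mem_world_iff p a b ref s).1 h with h | h
  · exact Or.inl h
  · exact Or.inr h.exists_eq

/-- **Reserved strings of a world**: `rsv z w` is in iff `w` is the witness placed at `z`. [folklore] -/
@[simp] theorem rsv_mem_world_iff (z w : List Bool) : rsv z w ∈ world p a b ref ↔ p z = some w := by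
  rw [mem_world_iff]
  simp [not_codeAcc_rsv]

/-- The code valuation relative to the part of a world below the code equals the valuation
relative to the whole world. [folklore] -/
theorem codeAcc_belowB_iff (s : List Bool) (a' b' : ℝ) (r : Prop) :
    CodeAcc (belowB (fun X s => s ∈ R p ∨ CodeAcc X (a s.length) (b s.length) (ref s) s) s.length)
        a' b' r s ↔ CodeAcc (world p a b ref) a' b' r s :=
  CodeAcc.congr (fun u hu => by rw [mem_belowB_iff]; exact ⟨fun h => h.1, fun h => ⟨h, by omega⟩⟩)
    Iff.rfl

/-- **Codes of a world** (the fixed-point equation): `ccode x m C` is in iff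
`a ≤ P ∨ (b < P ∧ ref)`, `P` the acceptance probability of `C` on `x` relative to the world.
[cite: Ko1989, §5 (p. 21)] -/
theorem ccode_mem_world_iff (x : List Bool) (m : ℕ) (C : QCircuit cliffordT (x.length + m)) :
    ccode x m C ∈ world p a b ref ↔
      a (ccode x m C).length ≤ C.acceptProb (world p a b ref) x.get ∨
        (b (ccode x m C).length < C.acceptProb (world p a b ref) x.get ∧ ref (ccode x m C)) := by
  rw [mem_world_iff, codeAcc_belowB_iff, codeAcc_ccode_iff]
  simp only [or_iff_right_iff_imp]
  intro h
  exact absurd h (cstr_not_mem_R p _)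

/-- A code whose circuit accepts with probability `≥ a` is in the world. [folklore] -/
theorem ccode_mem_world_of_le {x : List Bool} {m : ℕ} {C : QCircuit cliffordT (x.length + m)}
    (h : a (ccode x m C).length ≤ C.acceptProb (world p a b ref) x.get) : ccode x m C ∈ world p a b ref :=
  (ccode_mem_world_iff p a b ref x m C).2 (Or.inl h)

/-- A code whose circuit accepts with probability `< a` and `≤ b` is not in the world. [folklore] -/
theorem ccode_not_mem_world_of_lt {x : List Bool} {m : ℕ} {C : QCircuit cliffordT (x.length + m)}
    (ha : C.acceptProb (world p a b ref) x.get < a (ccode x m C).length)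
    (hb : C.acceptProb (world p a b ref) x.get ≤ b (ccode x m C).length) :
    ccode x m C ∉ world p a b ref := by
  rw [ccode_mem_world_iff]
  rintro (h | ⟨h, -⟩) <;> linarith

/-! ### `BQP^W ⊆ P^W` for every world with thresholds inside the promise gap -/

variable (F : QCircuitFamily cliffordT)

/-- The reduction map `x ↦ ccode x (F.ancillas |x|) (F.circ |x|)` of a circuit family (the code
string of `BQPCollapse.redFn`). [cite: Ko1989, §5 (p. 21, footnote 6)] -/
def credFn : List Bool → List Bool :=
  List.cons true ∘ fanoutFn (BQPCollapse.redFn F) fun _ => []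

/-- Semantics of the reduction map. [folklore] -/
theorem credFn_apply (x : List Bool) : credFn F x = ccode x (F.ancillas x.length) (F.circ x.length) := by
  simp [credFn, ccode, cstr, BQPCollapse.redFn_apply]

/-- The reduction map of a uniform family is in `FP`. [cite: AroraBarakCC2009, §1.3 and Thm. 2.8] -/
theorem credFn_mem_FP (hU : F.IsUniform) : credFn F ∈ FP :=
  comp_mem_FP (cons_mem_FP true)
    (fanoutFn_mem_FP (BQPCollapse.redFn_mem_FP F hU) (const_mem_FP []))

variable {a b}

/-- **Every `BQP^W` language Karp-reduces to the world `W`** when `1/3 < a ≤ 2/3`, `1/3 ≤ b`: the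
codes of a `BQP^W` family satisfy the promise, hence are valued correctly whatever the fallback.
[cite: Ko1989, §5 (p. 21) and p. 24 (2)] -/
theorem karpReducible_world (ha : ∀ ℓ, a ℓ ≤ 2 / 3) (ha' : ∀ ℓ, 1 / 3 < a ℓ) (hb : ∀ ℓ, 1 / 3 ≤ b ℓ)
    {L : Language Bool} (hL : L ∈ BQPRel (world p a b ref)) : L ≤ₚ world p a b ref := by
  obtain ⟨F, hU, hF⟩ := hL
  refine ⟨credFn F, credFn_mem_FP F hU, fun x => ?_⟩
  rw [credFn_apply]
  have h1 := (hF x).1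
  have h2 := (hF x).2
  simp only [QCircuitFamily.acceptProbOn] at h1 h2
  constructor
  · intro hx
    exact ccode_mem_world_of_le p a b ref ((ha _).trans (h1 hx))
  · intro h
    by_contra hx
    have := h2 hx
    exact ccode_not_mem_world_of_lt p a b ref
      (this.trans_lt (ha' (ccode x (F.ancillas x.length) (F.circ x.length)).length))
      (this.trans (hb _)) h

/-- **`BQP^W ⊆ P^W`** for every world with `1/3 < a ≤ 2/3`, `1/3 ≤ b` (Karp reductions are Cook
reductions). [cite: Ko1989, §5 (p. 21) and p. 24 (2)] [cite: FortnowRogers1999JCSS, Thm. 4.2 (arXiv numbering)] -/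
theorem BQPRel_world_subset_PRel (ha : ∀ ℓ, a ℓ ≤ 2 / 3) (ha' : ∀ ℓ, 1 / 3 < a ℓ) (hb : ∀ ℓ, 1 / 3 ≤ b ℓ) :
    BQPRel (world p a b ref) ⊆ PRel (Oracle.ofLanguage (world p a b ref)) :=
  fun _ hL => PolyTimeKarpReducible.turing_holds (karpReducible_world p ref ha ha' hb hL)

variable (a b)

/-- **Agreement principle for worlds.** Two worlds agree on a set `S` of strings provided: the
placements agree on the reserved strings of `S`; thresholds and fallbacks agree on `S`; and `S`
contains, with every code `s ∈ S`, every string `u` with `2|u| + 7 ≤ |s|` (all the strings the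
circuit of `s` may query). [folklore] -/
theorem world_congr {p₁ p₂ : List Bool → Option (List Bool)} {a₁ b₁ a₂ b₂ : ℕ → ℝ}
    {ref₁ ref₂ : List Bool → Prop} (S : Set (List Bool))
    (hp : ∀ z w, rsv z w ∈ S → (p₁ z = some w ↔ p₂ z = some w))
    (ha : ∀ s ∈ S, a₁ s.length = a₂ s.length) (hb : ∀ s ∈ S, b₁ s.length = b₂ s.length)
    (href : ∀ s ∈ S, (ref₁ s ↔ ref₂ s))
    (hS : ∀ s ∈ S, (∃ (x : List Bool) (m : ℕ) (C : QCircuit cliffordT (x.length + m)), s = ccode x m C) →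
      ∀ u : List Bool, 2 * u.length + 7 ≤ s.length → u ∈ S) :
    ∀ s ∈ S, s ∈ world p₁ a₁ b₁ ref₁ ↔ s ∈ world p₂ a₂ b₂ ref₂ := by
  refine build_congr S fun s hs X₁ X₂ hX => ?_
  have hR : s ∈ R p₁ ↔ s ∈ R p₂ := by
    constructor
    · rintro ⟨z, w, h, rfl⟩
      exact rsv_mem_R_iff.2 ((hp z w hs).1 h)
    · rintro ⟨z, w, h, rfl⟩
      exact rsv_mem_R_iff.2 ((hp z w hs).2 h)
  refine or_congr hR ?_
  by_cases hc : ∃ (x : List Bool) (m : ℕ) (C : QCircuit cliffordT (x.length + m)), s = ccode x m C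
  · rw [ha s hs, hb s hs]
    exact CodeAcc.congr (fun u hu => hX u (hS s hs hc u hu) (by omega)) (href s hs)
  · constructor
    · exact fun h => absurd h.exists_eq hc
    · exact fun h => absurd h.exists_eq hc

end World

end FRO

end Literature.Computability.QuantumComplexity

end
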